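import Mathlib.Analysis.SpecialFunctions.JapaneseBracket
import Mathlib.Analysis.SpecialFunctions.Pow.Asymptotics
import Literature.Barriers.QuantumFields.NoClassicalGlueballsStressTensor
import Literature.Barriers.QuantumFields.NoClassicalGlueballsSlices
import HarnessLib

/-!
# No classical glueballs: decay estimates and energy conservation (proofs, part 3)

Sibling proof file of `Literature/Barriers/QuantumFields/NoClassicalGlueballs.lean` (third of the
files discharging `ColemanNoClassicalGlueballs`, Coleman 1977). Under Coleman's hypotheses —
a smooth `𝔤`-valued finite-energy solution of the Yang–Mills equations on `ℝ^{1+3}` obeying the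
no-outgoing-radiation condition (10) uniformly in `t > 0`, bundled as `ColemanHypotheses 𝔤 B A`
together with an invariant positive form `B` — this file proves:

* `ColemanHypotheses.exists_radius`: the quantitative content of (10) with `ε = ¼`: beyond some
  radius `R₀ ≥ 1`, uniformly in `t > 0`, `θ₀₀(t, y) ≤ r^{-1/4} g(y)` for `r ≤ |y|`, where
  `g(y) = 4·2^{13/4} (1 + |y|)^{-13/4}` is integrable on `ℝ³` (`energyMajorant`);
* the shell/tail estimates this buys (`abs_integral_mul_le_of_vanish`, the cutoff-gradient
  lemmas) and
* **conservation of energy for positive times**, `ColemanHypotheses.ymEnergyAt_eq`: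
  `E(t₁) = E(t₂)` for `0 < t₁, t₂` ("the space integral of `θ₀₀`", Coleman §2; Glassey–Strauss
  §3 `∫ e dx = const`), obtained from the transport lemma applied to `∂₀θ₀₀ = Σ_j ∂_jθ_{j0}` with
  the cutoffs `Literature.Analysis.FluidPDE.cutoff R`, the flux through the shell `R ≤ |y| ≤ 2R` being
  `O(R^{-1/4})` uniformly in `t > 0` by (10).

## References

* S. Coleman, *There are no classical glueballs*, Commun. Math. Phys. 55 (1977) 113–116, §2
  (9)–(12) [Coleman1977].
* R. T. Glassey, W. A. Strauss, Commun. Math. Phys. 65 (1979) 1–13, §3 (e), "conservation of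
  energy" [GlasseyStrauss1979].
-/

noncomputable section

open scoped ContDiff
open MeasureTheory Set Filter Topology Function Metric

namespace Literature.Barriers.QuantumFields

open Literature.MathematicalPhysics.QuantumLattice Literature.Analysis.FluidPDE

variable {𝔸 : Type*} [NormedRing 𝔸] [NormedAlgebra ℝ 𝔸]

/-! ### Coleman's hypotheses -/

/-- **Coleman's hypotheses** on a classical Yang–Mills field on `ℝ^{1+3}` with coefficients in
the real normed algebra `𝔸`: an `ad(𝔤)`-invariant positive form `B` on `𝔸`, a `𝔤`-valued smooth
("non-singular") connection `A` solving the Yang–Mills equations, of finite energy at every time,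
and obeying the no-outgoing-radiation condition (10) uniformly in direction and in `t > 0`.
[cite: Coleman1977, §2 (1)–(2), (10)] -/
structure ColemanHypotheses (𝔤 : Submodule ℝ 𝔸) (B : 𝔸 →L[ℝ] 𝔸 →L[ℝ] ℝ)
    (A : Connection (SpaceTime 3) 𝔸) : Prop where
  form : IsInvariantForm 𝔤 B
  valuedIn : A.IsValuedIn 𝔤
  smooth : IsSmoothConnection A
  solution : IsMinkowskiYangMills A
  finiteEnergy : HasFiniteYMEnergy A
  nonRadiating : IsNonRadiating A

/-! ### The integrable majorant and the splitting of the decay rate `7/2 = 1/4 + 13/4` -/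

/-- The integrable majorant `g(y) = 4·2^{13/4} (1 + |y|)^{-13/4}` on `ℝ³`. [folklore] -/
def energyMajorant (y : EuclideanSpace ℝ (Fin 3)) : ℝ :=
  4 * (2 : ℝ) ^ (13 / 4 : ℝ) * (1 + ‖y‖) ^ (-(13 / 4 : ℝ))

/-- `g ≥ 0`. [folklore] -/
theorem energyMajorant_nonneg (y : EuclideanSpace ℝ (Fin 3)) : 0 ≤ energyMajorant y := by
  unfold energyMajorant; positivity

/-- `g` is integrable on `ℝ³` (`13/4 > 3 = dim`; Mathlib `integrable_one_add_norm`). [folklore] -/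
theorem integrable_energyMajorant : Integrable energyMajorant := by
  have h : Integrable fun y : EuclideanSpace ℝ (Fin 3) => (1 + ‖y‖) ^ (-(13 / 4 : ℝ)) :=
    integrable_one_add_norm (by rw [finrank_euclideanSpace_fin]; norm_num)
  exact h.const_mul _

/-- `∫ g ≥ 0`. [folklore] -/
theorem integral_energyMajorant_nonneg : 0 ≤ ∫ y, energyMajorant y :=
  integral_nonneg energyMajorant_nonneg

/-- The elementary splitting `4 s^{-7/2} ≤ r^{-1/4} · g(s)` for `1 ≤ r ≤ s`
(`s^{-7/2} = s^{-1/4} s^{-13/4}`, `s^{-1/4} ≤ r^{-1/4}`, `s^{-13/4} ≤ 2^{13/4}(1+s)^{-13/4}`).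
[folklore] -/
theorem four_mul_rpow_le {r s : ℝ} (hr : 1 ≤ r) (hrs : r ≤ s) :
    4 * s ^ (-(7 / 2 : ℝ)) ≤
      r ^ (-(1 / 4 : ℝ)) * (4 * (2 : ℝ) ^ (13 / 4 : ℝ) * (1 + s) ^ (-(13 / 4 : ℝ))) := by
  have hs : 0 < s := by linarith
  have hr0 : 0 < r := by linarith
  have h1 : s ^ (-(7 / 2 : ℝ)) = s ^ (-(1 / 4 : ℝ)) * s ^ (-(13 / 4 : ℝ)) := by
    rw [← Real.rpow_add hs]; norm_num
  have h2 : s ^ (-(1 / 4 : ℝ)) ≤ r ^ (-(1 / 4 : ℝ)) :=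
    Real.rpow_le_rpow_of_nonpos hr0 hrs (by norm_num)
  have h3 : s ^ (-(13 / 4 : ℝ)) ≤ (2 : ℝ) ^ (13 / 4 : ℝ) * (1 + s) ^ (-(13 / 4 : ℝ)) := by
    have h4 : (2 * s) ^ (-(13 / 4 : ℝ)) ≤ (1 + s) ^ (-(13 / 4 : ℝ)) :=
      Real.rpow_le_rpow_of_nonpos (by linarith) (by linarith) (by norm_num)
    rw [Real.mul_rpow (by norm_num) hs.le] at h4
    have h5 : (2 : ℝ) ^ (13 / 4 : ℝ) * (2 : ℝ) ^ (-(13 / 4 : ℝ)) = 1 := by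
      rw [← Real.rpow_add (by norm_num)]; norm_num
    calc s ^ (-(13 / 4 : ℝ)) = (2 : ℝ) ^ (13 / 4 : ℝ) * ((2 : ℝ) ^ (-(13 / 4 : ℝ)) * s ^ (-(13 / 4 : ℝ))) := by
          rw [← mul_assoc, h5, one_mul]
      _ ≤ (2 : ℝ) ^ (13 / 4 : ℝ) * (1 + s) ^ (-(13 / 4 : ℝ)) :=
          mul_le_mul_of_nonneg_left h4 (by positivity)
  have h6 : 0 ≤ s ^ (-(13 / 4 : ℝ)) := by positivity
  have h7 : 0 ≤ r ^ (-(1 / 4 : ℝ)) := by positivity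
  calc 4 * s ^ (-(7 / 2 : ℝ)) = 4 * (s ^ (-(1 / 4 : ℝ)) * s ^ (-(13 / 4 : ℝ))) := by rw [h1]
    _ ≤ 4 * (r ^ (-(1 / 4 : ℝ)) * ((2 : ℝ) ^ (13 / 4 : ℝ) * (1 + s) ^ (-(13 / 4 : ℝ)))) := by
        gcongr
    _ = _ := by ring

/-- `r ↦ K r^{-1/4} → 0`. [folklore] -/
theorem tendsto_const_mul_rpow_neg_quarter (K : ℝ) :
    Tendsto (fun r : ℝ => K * r ^ (-(1 / 4 : ℝ))) atTop (𝓝 0) := by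
  simpa using (tendsto_rpow_neg_atTop (by norm_num : (0 : ℝ) < 1 / 4)).const_mul K

/-! ### The decay hypothesis (10), quantitatively -/

namespace ColemanHypotheses

variable {𝔤 : Submodule ℝ 𝔸} {B : 𝔸 →L[ℝ] 𝔸 →L[ℝ] ℝ} {A : Connection (SpaceTime 3) 𝔸}

/-- **What (10) buys (ε = ¼).** There is `R₀ ≥ 1` such that for all `t > 0`, `r ≥ R₀` and
`|y| ≥ r`: `θ₀₀(t, y) ≤ r^{-1/4} g(y)` — from `|y|^{7/4} ‖F_{μν}(t, y)‖ < 1` for all sixteen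
components and `θ₀₀ = ¼ Σ ‖F_{μν}‖²`. [cite: Coleman1977, §2 (10)] -/
theorem exists_radius (h : ColemanHypotheses 𝔤 B A) :
    ∃ R₀ : ℝ, 1 ≤ R₀ ∧ ∀ t : ℝ, 0 < t → ∀ r : ℝ, R₀ ≤ r → ∀ y : EuclideanSpace ℝ (Fin 3),
      r ≤ ‖y‖ → ymEnergyDensity A (ofTimeSpace t y) ≤ r ^ (-(1 / 4 : ℝ)) * energyMajorant y := by
  have h10 := h.nonRadiating (1 / 4) (by norm_num) (by norm_num)
  choose R hR using fun μ ν => h10 μ ν 1 one_pos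
  refine ⟨1 + ∑ μ, ∑ ν, |R μ ν|, by
    have : 0 ≤ ∑ μ, ∑ ν, |R μ ν| := Finset.sum_nonneg fun μ _ => Finset.sum_nonneg fun ν _ =>
      abs_nonneg _
    linarith, fun t ht r hr y hy => ?_⟩
  have hRle : ∀ μ ν, R μ ν ≤ ‖y‖ := by
    intro μ ν
    have h1 : |R μ ν| ≤ ∑ ν', |R μ ν'| :=
      Finset.single_le_sum (f := fun ν' => |R μ ν'|) (fun _ _ => abs_nonneg _) (Finset.mem_univ ν)
    have h2 : ∑ ν', |R μ ν'| ≤ ∑ μ', ∑ ν', |R μ' ν'| :=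
      Finset.single_le_sum (f := fun μ' => ∑ ν', |R μ' ν'|)
        (fun _ _ => Finset.sum_nonneg fun _ _ => abs_nonneg _) (Finset.mem_univ μ)
    linarith [le_abs_self (R μ ν)]
  have hr1 : 1 ≤ r := by
    have : 0 ≤ ∑ μ, ∑ ν, |R μ ν| := Finset.sum_nonneg fun μ _ => Finset.sum_nonneg fun ν _ =>
      abs_nonneg _
    linarith
  have hs : 0 < ‖y‖ := by linarith
  -- each component: `‖F_{μν}(t,y)‖² ≤ |y|^{-7/2}`
  have hF : ∀ μ ν, ‖fieldStrength A μ ν (ofTimeSpace t y)‖ ^ 2 ≤ ‖y‖ ^ (-(7 / 2 : ℝ)) := by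
    intro μ ν
    have h1 := hR μ ν t ht y (hRle μ ν)
    rw [show (3 : ℝ) / 2 + 1 / 4 = 7 / 4 by norm_num] at h1
    have hpos : 0 < ‖y‖ ^ (7 / 4 : ℝ) := Real.rpow_pos_of_pos hs _
    have h2 : ‖fieldStrength A μ ν (ofTimeSpace t y)‖ ≤ ‖y‖ ^ (-(7 / 4 : ℝ)) := by
      rw [Real.rpow_neg hs.le, inv_eq_one_div, le_div_iff₀ hpos, mul_comm]
      exact h1.le
    calc ‖fieldStrength A μ ν (ofTimeSpace t y)‖ ^ 2 ≤ (‖y‖ ^ (-(7 / 4 : ℝ))) ^ 2 :=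
          pow_le_pow_left₀ (norm_nonneg _) h2 2
      _ = ‖y‖ ^ (-(7 / 2 : ℝ)) := by
          rw [← Real.rpow_natCast, ← Real.rpow_mul hs.le]; norm_num
  have hsum := sum_norm_sq_fieldStrength (A := A) (ofTimeSpace t y)
  have hle : ∑ κ : Fin 4, ∑ ρ : Fin 4, ‖fieldStrength A κ ρ (ofTimeSpace t y)‖ ^ 2 ≤
      16 * ‖y‖ ^ (-(7 / 2 : ℝ)) := by
    calc ∑ κ : Fin 4, ∑ ρ : Fin 4, ‖fieldStrength A κ ρ (ofTimeSpace t y)‖ ^ 2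
        ≤ ∑ _κ : Fin 4, ∑ _ρ : Fin 4, ‖y‖ ^ (-(7 / 2 : ℝ)) :=
          Finset.sum_le_sum fun κ _ => Finset.sum_le_sum fun ρ _ => hF κ ρ
      _ = 16 * ‖y‖ ^ (-(7 / 2 : ℝ)) := by simp; ring
  calc ymEnergyDensity A (ofTimeSpace t y) ≤ 4 * ‖y‖ ^ (-(7 / 2 : ℝ)) := by linarith
    _ ≤ r ^ (-(1 / 4 : ℝ)) * energyMajorant y := four_mul_rpow_le hr1 hy

/-- The same bound for all stress components: `|θ_{μν}(t, y)| ≤ 5 r^{-1/4} g(y)`.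
[cite: Coleman1977, §2 (9)–(10)] -/
theorem abs_stressTensor_le_majorant (h : ColemanHypotheses 𝔤 B A) {R₀ : ℝ}
    (hR₀ : ∀ t : ℝ, 0 < t → ∀ r : ℝ, R₀ ≤ r → ∀ y : EuclideanSpace ℝ (Fin 3),
      r ≤ ‖y‖ → ymEnergyDensity A (ofTimeSpace t y) ≤ r ^ (-(1 / 4 : ℝ)) * energyMajorant y)
    {t : ℝ} (ht : 0 < t) {r : ℝ} (hr : R₀ ≤ r) {y : EuclideanSpace ℝ (Fin 3)} (hy : r ≤ ‖y‖)
    (μ ν : Fin 4) :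
    |stressTensor B A μ ν (ofTimeSpace t y)| ≤ 5 * (r ^ (-(1 / 4 : ℝ)) * energyMajorant y) :=
  (abs_stressTensor_le h.form μ ν _).trans (by linarith [hR₀ t ht r hr y hy])

end ColemanHypotheses

/-! ### Cutoffs: vanishing of the gradient off the shell, and the shell/tail comparison -/

section Cutoff

/-- The universal gradient constant of the cutoff family on `ℝ³` (`‖∇χ_R‖ ≤ C/R`), chosen once.
[folklore] -/
def cutoffGradConst : ℝ :=
  Classical.choose (exists_norm_fderiv_cutoff_le (E := EuclideanSpace ℝ (Fin 3)))

/-- `0 ≤ C` and `‖∇χ_R(y)‖ ≤ C / R`. [folklore] -/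
theorem cutoffGradConst_spec : 0 ≤ cutoffGradConst ∧ ∀ R : ℝ, 0 < R →
    ∀ y : EuclideanSpace ℝ (Fin 3), ‖fderiv ℝ (cutoff R) y‖ ≤ cutoffGradConst / R :=
  Classical.choose_spec (exists_norm_fderiv_cutoff_le (E := EuclideanSpace ℝ (Fin 3)))

/-- `|∂_jχ_R(y)| ≤ C / R`. [folklore] -/
theorem abs_fderiv_cutoff_single_le {R : ℝ} (hR : 0 < R) (y : EuclideanSpace ℝ (Fin 3))
    (j : Fin 3) : |fderiv ℝ (cutoff R) y (EuclideanSpace.single j 1)| ≤ cutoffGradConst / R := by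
  have h1 := (fderiv ℝ (cutoff R) y).le_opNorm (EuclideanSpace.single j 1)
  have h2 : ‖(EuclideanSpace.single j (1 : ℝ) : EuclideanSpace ℝ (Fin 3))‖ = 1 := by simp
  rw [h2, mul_one, Real.norm_eq_abs] at h1
  exact h1.trans (cutoffGradConst_spec.2 R hR y)

/-- Inside the ball `|y| < R` the cutoff is locally constant, so its gradient vanishes.
[folklore] -/
theorem fderiv_cutoff_eq_zero_of_norm_lt {R : ℝ} (hR : 0 < R) {y : EuclideanSpace ℝ (Fin 3)}
    (hy : ‖y‖ < R) : fderiv ℝ (cutoff R) y = 0 := by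
  have h : (cutoff R : EuclideanSpace ℝ (Fin 3) → ℝ) =ᶠ[𝓝 y] fun _ => 1 := by
    filter_upwards [(isOpen_lt continuous_norm continuous_const).mem_nhds hy] with z hz
    exact cutoff_eq_one hR (le_of_lt hz)
  rw [h.fderiv_eq]
  simp

/-- Outside the ball `|y| > 2R` the cutoff vanishes identically near `y`, so its gradient
vanishes. [folklore] -/
theorem fderiv_cutoff_eq_zero_of_lt_norm {R : ℝ} (hR : 0 < R) {y : EuclideanSpace ℝ (Fin 3)}
    (hy : 2 * R < ‖y‖) : fderiv ℝ (cutoff R) y = 0 := by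
  have h : (cutoff R : EuclideanSpace ℝ (Fin 3) → ℝ) =ᶠ[𝓝 y] fun _ => 0 := by
    filter_upwards [(isOpen_lt continuous_const continuous_norm).mem_nhds hy] with z hz
    exact cutoff_eq_zero hR (le_of_lt hz)
  rw [h.fderiv_eq]
  simp

/-- **Shell/tail comparison.** If `|w| ≤ W`, `w` vanishes inside the ball of radius `r`, and
`|h(y)| ≤ H(y)` for `|y| ≥ r` with `H ≥ 0` integrable, then `|∫ w h| ≤ W ∫ H`. [folklore] -/
theorem abs_integral_mul_le_of_vanish {w h H : EuclideanSpace ℝ (Fin 3) → ℝ} {W r : ℝ}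
    (hW0 : 0 ≤ W) (hW : ∀ y, |w y| ≤ W) (hw0 : ∀ y, ‖y‖ < r → w y = 0)
    (hH : ∀ y, r ≤ ‖y‖ → |h y| ≤ H y) (hH0 : ∀ y, 0 ≤ H y) (hHi : Integrable H) :
    |∫ y, w y * h y| ≤ W * ∫ y, H y := by
  have hpt : ∀ y, ‖w y * h y‖ ≤ W * H y := by
    intro y
    rw [Real.norm_eq_abs, abs_mul]
    by_cases hy : ‖y‖ < r
    · rw [hw0 y hy, abs_zero, zero_mul]; exact mul_nonneg hW0 (hH0 y)
    · exact mul_le_mul (hW y) (hH y (not_lt.1 hy)) (abs_nonneg _) hW0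
  have := norm_integral_le_of_norm_le (hHi.const_mul W) (ae_of_all _ hpt)
  rw [integral_const_mul, Real.norm_eq_abs] at this
  exact this

end Cutoff

/-! ### Conservation of energy for `t > 0` -/

namespace ColemanHypotheses

variable {𝔤 : Submodule ℝ 𝔸} {B : 𝔸 →L[ℝ] 𝔸 →L[ℝ] ℝ} {A : Connection (SpaceTime 3) 𝔸}

/-- The regularised energy `I_R(t) = ∫ χ_R(y) θ₀₀(t, y) dy` is differentiable in `t`, with
derivative minus the flux through the shell:
`I_R'(t) = −Σ_j ∫ ∂_jχ_R(y) θ_{j+1,0}(t, y) dy` (transport lemma with `∂₀θ₀₀ = Σ_j ∂_jθ_{j0}`).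
[cite: Coleman1977, §2 (4), (12)] -/
theorem hasDerivAt_cutoffEnergy (h : ColemanHypotheses 𝔤 B A) {R : ℝ} (hR : 0 < R) (t : ℝ) :
    HasDerivAt (fun s => ∫ y, cutoff R y * stressTensor B A 0 0 (ofTimeSpace s y))
      (-(∑ j : Fin 3, ∫ y, fderiv ℝ (cutoff R) y (EuclideanSpace.single j 1) *
        stressTensor B A j.succ 0 (ofTimeSpace t y))) t :=
  hasDerivAt_integral_mul_slice (contDiff_stressTensor h.smooth 0 0)
    (fun j => contDiff_stressTensor h.smooth j.succ 0)
    (fun x => fderiv_stressTensor_zero h.form h.valuedIn h.smooth h.solution 0 x)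
    (contDiff_cutoff R) (hasCompactSupport_cutoff hR) t

/-- **The flux through the shell is small, uniformly in `t > 0`:** for `R ≥ R₀`,
`|Σ_j ∫ ∂_jχ_R θ_{j+1,0}(t, ·)| ≤ 15 C ‖g‖₁ R^{-1/4}` (gradient bound `C/R ≤ C`, vanishing of
`∇χ_R` inside `|y| < R`, and `|θ| ≤ 5 R^{-1/4} g` outside). [cite: Coleman1977, §2 (10), (12)] -/
theorem abs_flux_le (h : ColemanHypotheses 𝔤 B A) {R₀ : ℝ} (hR₀1 : 1 ≤ R₀)
    (hR₀ : ∀ t : ℝ, 0 < t → ∀ r : ℝ, R₀ ≤ r → ∀ y : EuclideanSpace ℝ (Fin 3),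
      r ≤ ‖y‖ → ymEnergyDensity A (ofTimeSpace t y) ≤ r ^ (-(1 / 4 : ℝ)) * energyMajorant y)
    {t : ℝ} (ht : 0 < t) {R : ℝ} (hR : R₀ ≤ R) :
    |∑ j : Fin 3, ∫ y, fderiv ℝ (cutoff R) y (EuclideanSpace.single j 1) *
        stressTensor B A j.succ 0 (ofTimeSpace t y)| ≤
      15 * cutoffGradConst * (∫ y, energyMajorant y) * R ^ (-(1 / 4 : ℝ)) := by
  have hRpos : 0 < R := by linarith
  have hC := cutoffGradConst_spec.1
  have hj : ∀ j : Fin 3, |∫ y, fderiv ℝ (cutoff R) y (EuclideanSpace.single j 1) *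
      stressTensor B A j.succ 0 (ofTimeSpace t y)| ≤
      cutoffGradConst * ∫ y, 5 * (R ^ (-(1 / 4 : ℝ)) * energyMajorant y) := by
    intro j
    refine abs_integral_mul_le_of_vanish (r := R) hC (fun y => ?_) (fun y hy => ?_)
      (fun y hy => h.abs_stressTensor_le_majorant hR₀ ht hR hy _ _) (fun y => by
        have := energyMajorant_nonneg y; positivity)
      ((integrable_energyMajorant.const_mul _).const_mul _)
    · refine (abs_fderiv_cutoff_single_le hRpos y j).trans ?_
      rw [div_le_iff₀ hRpos]
      nlinarith
    · rw [fderiv_cutoff_eq_zero_of_norm_lt hRpos hy]; simp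
  calc |∑ j : Fin 3, ∫ y, fderiv ℝ (cutoff R) y (EuclideanSpace.single j 1) *
        stressTensor B A j.succ 0 (ofTimeSpace t y)|
      ≤ ∑ j : Fin 3, |∫ y, fderiv ℝ (cutoff R) y (EuclideanSpace.single j 1) *
        stressTensor B A j.succ 0 (ofTimeSpace t y)| := Finset.abs_sum_le_sum_abs _ _
    _ ≤ ∑ _j : Fin 3, cutoffGradConst * ∫ y, 5 * (R ^ (-(1 / 4 : ℝ)) * energyMajorant y) :=
        Finset.sum_le_sum fun j _ => hj j
    _ = 15 * cutoffGradConst * (∫ y, energyMajorant y) * R ^ (-(1 / 4 : ℝ)) := by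
        rw [Finset.sum_const, Finset.card_univ, Fintype.card_fin, integral_const_mul,
          integral_const_mul]
        simp only [nsmul_eq_mul, Nat.cast_ofNat]
        ring

/-- **The tail of the energy is small, uniformly in `t > 0`:** for `R ≥ R₀`,
`0 ≤ E(t) − ∫ χ_R θ₀₀(t, ·) ≤ ‖g‖₁ R^{-1/4}`. [cite: Coleman1977, §2 (10), (12)] -/
theorem energy_sub_cutoffEnergy (h : ColemanHypotheses 𝔤 B A) {R₀ : ℝ} (hR₀1 : 1 ≤ R₀)
    (hR₀ : ∀ t : ℝ, 0 < t → ∀ r : ℝ, R₀ ≤ r → ∀ y : EuclideanSpace ℝ (Fin 3),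
      r ≤ ‖y‖ → ymEnergyDensity A (ofTimeSpace t y) ≤ r ^ (-(1 / 4 : ℝ)) * energyMajorant y)
    {t : ℝ} (ht : 0 < t) {R : ℝ} (hR : R₀ ≤ R) :
    0 ≤ ymEnergyAt A t - ∫ y, cutoff R y * stressTensor B A 0 0 (ofTimeSpace t y) ∧
      ymEnergyAt A t - ∫ y, cutoff R y * stressTensor B A 0 0 (ofTimeSpace t y) ≤
        (∫ y, energyMajorant y) * R ^ (-(1 / 4 : ℝ)) := by
  have hRpos : 0 < R := by linarith
  have he : ∀ y, stressTensor B A 0 0 (ofTimeSpace t y) = ymEnergyDensity A (ofTimeSpace t y) :=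
    fun y => stressTensor_zero_zero h.form _
  simp_rw [he]
  have hint : Integrable fun y => ymEnergyDensity A (ofTimeSpace t y) := h.finiteEnergy t
  have hint2 : Integrable fun y => cutoff R y * ymEnergyDensity A (ofTimeSpace t y) := by
    refine hint.mono' (((contDiff_cutoff (n := 0) R).continuous.aestronglyMeasurable).mul
      hint.aestronglyMeasurable) (ae_of_all _ fun y => ?_)
    rw [Real.norm_eq_abs, abs_mul, abs_of_nonneg (cutoff_nonneg R y),
      abs_of_nonneg (ymEnergyDensity_nonneg A _)]
    exact mul_le_of_le_one_left (ymEnergyDensity_nonneg A _) (cutoff_le_one R y)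
  have hsub : ymEnergyAt A t - ∫ y, cutoff R y * ymEnergyDensity A (ofTimeSpace t y) =
      ∫ y, (1 - cutoff R y) * ymEnergyDensity A (ofTimeSpace t y) := by
    rw [ymEnergyAt, ← integral_sub hint hint2]
    congr 1; funext y; ring
  rw [hsub]
  have hpt0 : ∀ y, 0 ≤ (1 - cutoff R y) * ymEnergyDensity A (ofTimeSpace t y) := fun y =>
    mul_nonneg (by linarith [cutoff_le_one R y]) (ymEnergyDensity_nonneg A _)
  have hpt : ∀ y, (1 - cutoff R y) * ymEnergyDensity A (ofTimeSpace t y) ≤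
      R ^ (-(1 / 4 : ℝ)) * energyMajorant y := by
    intro y
    by_cases hy : ‖y‖ ≤ R
    · rw [cutoff_eq_one hRpos hy, sub_self, zero_mul]
      exact mul_nonneg (by positivity) (energyMajorant_nonneg y)
    · calc (1 - cutoff R y) * ymEnergyDensity A (ofTimeSpace t y)
          ≤ 1 * ymEnergyDensity A (ofTimeSpace t y) :=
            mul_le_mul_of_nonneg_right (by linarith [cutoff_nonneg R y])
              (ymEnergyDensity_nonneg A _)
        _ ≤ R ^ (-(1 / 4 : ℝ)) * energyMajorant y := by
            rw [one_mul]; exact hR₀ t ht R hR y (le_of_lt (not_le.1 hy))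
  refine ⟨integral_nonneg hpt0, ?_⟩
  calc ∫ y, (1 - cutoff R y) * ymEnergyDensity A (ofTimeSpace t y)
      ≤ ∫ y, R ^ (-(1 / 4 : ℝ)) * energyMajorant y :=
        integral_mono_of_nonneg (ae_of_all _ hpt0) (integrable_energyMajorant.const_mul _)
          (ae_of_all _ hpt)
    _ = (∫ y, energyMajorant y) * R ^ (-(1 / 4 : ℝ)) := by rw [integral_const_mul]; ring

/-- **Conservation of energy for positive times** (Coleman: "E is the energy, the space integral
of `θ₀₀`"; Glassey–Strauss §3, `∫ e(E,H) dx = const`): under Coleman's hypotheses the energy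
`E(t) = ∫ θ₀₀(t, y) dy` is the same at all times `t > 0`. Proof: `|I_R(t₂) − I_R(t₁)| ≤
(t₂ − t₁) · 15C‖g‖₁R^{-1/4}` by the mean value inequality, `|E(t) − I_R(t)| ≤ ‖g‖₁R^{-1/4}`,
and `R → ∞`. [cite: Coleman1977, §2 (4), (11)–(12)] [cite: GlasseyStrauss1979, §3 (e)] -/
theorem ymEnergyAt_eq (h : ColemanHypotheses 𝔤 B A) {t₁ t₂ : ℝ} (ht₁ : 0 < t₁) (ht₂ : 0 < t₂) :
    ymEnergyAt A t₁ = ymEnergyAt A t₂ := by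
  wlog hle : t₁ ≤ t₂ generalizing t₁ t₂
  · exact (this ht₂ ht₁ (le_of_not_ge hle)).symm
  obtain ⟨R₀, hR₀1, hR₀⟩ := h.exists_radius
  set K : ℝ := (t₂ - t₁) * (15 * cutoffGradConst * ∫ y, energyMajorant y) +
    2 * ∫ y, energyMajorant y with hK
  -- for every `R ≥ R₀`: `|E(t₂) - E(t₁)| ≤ K R^{-1/4}`
  have hbound : ∀ R : ℝ, R₀ ≤ R → |ymEnergyAt A t₂ - ymEnergyAt A t₁| ≤ K * R ^ (-(1 / 4 : ℝ)) := by
    intro R hR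
    have hRpos : 0 < R := by linarith
    -- mean value inequality on `[t₁, t₂]`
    have hmv : |(∫ y, cutoff R y * stressTensor B A 0 0 (ofTimeSpace t₂ y)) -
        ∫ y, cutoff R y * stressTensor B A 0 0 (ofTimeSpace t₁ y)| ≤
        15 * cutoffGradConst * (∫ y, energyMajorant y) * R ^ (-(1 / 4 : ℝ)) * (t₂ - t₁) := by
      have hderiv : ∀ s ∈ Icc t₁ t₂, HasDerivWithinAt
          (fun s => ∫ y, cutoff R y * stressTensor B A 0 0 (ofTimeSpace s y))
          (-(∑ j : Fin 3, ∫ y, fderiv ℝ (cutoff R) y (EuclideanSpace.single j 1) *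
            stressTensor B A j.succ 0 (ofTimeSpace s y))) (Icc t₁ t₂) s :=
        fun s _ => (h.hasDerivAt_cutoffEnergy hRpos s).hasDerivWithinAt
      have hb : ∀ s ∈ Ico t₁ t₂, ‖-(∑ j : Fin 3, ∫ y, fderiv ℝ (cutoff R) y
          (EuclideanSpace.single j 1) * stressTensor B A j.succ 0 (ofTimeSpace s y))‖ ≤
          15 * cutoffGradConst * (∫ y, energyMajorant y) * R ^ (-(1 / 4 : ℝ)) := by
        intro s hs
        rw [norm_neg, Real.norm_eq_abs]
        exact h.abs_flux_le hR₀1 hR₀ (lt_of_lt_of_le ht₁ hs.1) hR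
      have := norm_image_sub_le_of_norm_deriv_le_segment' hderiv hb t₂
        (right_mem_Icc.2 hle)
      rw [Real.norm_eq_abs] at this
      exact this
    have h1 := h.energy_sub_cutoffEnergy hR₀1 hR₀ ht₁ hR
    have h2 := h.energy_sub_cutoffEnergy hR₀1 hR₀ ht₂ hR
    have hK0 : (t₂ - t₁) * (15 * cutoffGradConst * ∫ y, energyMajorant y) *
        R ^ (-(1 / 4 : ℝ)) + 2 * (∫ y, energyMajorant y) * R ^ (-(1 / 4 : ℝ)) =
        K * R ^ (-(1 / 4 : ℝ)) := by rw [hK]; ring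
    rw [← hK0, abs_le]
    obtain ⟨hmv1, hmv2⟩ := abs_le.1 hmv
    constructor
    · linarith [h1.1, h1.2, h2.1, h2.2]
    · linarith [h1.1, h1.2, h2.1, h2.2]
  -- let `R → ∞`
  have hlim : Tendsto (fun R : ℝ => K * R ^ (-(1 / 4 : ℝ))) atTop (𝓝 0) :=
    tendsto_const_mul_rpow_neg_quarter K
  have hle0 : |ymEnergyAt A t₂ - ymEnergyAt A t₁| ≤ 0 :=
    ge_of_tendsto hlim (Filter.eventually_atTop.2 ⟨R₀, hbound⟩)
  have := abs_nonneg (ymEnergyAt A t₂ - ymEnergyAt A t₁)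
  have h0 : ymEnergyAt A t₂ - ymEnergyAt A t₁ = 0 := abs_eq_zero.1 (le_antisymm hle0 this)
  linarith

end ColemanHypotheses

end Literature.Barriers.QuantumFields
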